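import Summits.AtomisticToContinuum.BoseEinsteinCondensation.Theorems.BECThomsonPrincipleGDTransferSeededPlainInteractionPairs
import Summits.AtomisticToContinuum.BoseEinsteinCondensation.Theorems.BECThomsonPrincipleGDTransferSeededGradingDefs

/-!
# Route `BECThomsonPrinciple`, crux `GDTransfer` (stmt-AtomisticToContinuum-9482), line `seeded-continuity`:
# stub `interactionLocality` — the interaction form has `Q_S`-bandwidth two

Supports (does not close) stmt-AtomisticToContinuum-9482.  Registered stub
`interactionLocality : InteractionLocality` of the lead's fixed-`N` seed programme (`…SeededGradingDefs`):
for a finite continuous finite-range profile `v` and continuous `f`, `𝓥(Q_S f, Q_T f) = 0` as soon as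
`T ∖ S` has at least three elements.

Proof.  The real interaction is the finite sum of the continuous pair weights
`w_{pq}(X) = v^per(x_p − x_q)` (`PlainInteraction.toReal_periodicInteraction`), so
`𝓥(Q_S f, Q_T f) = Σ_{p<q} ∫ w_{pq} conj(Q_S f) Q_T f` (`PlainInteraction.form_sum_weight`).  For the pair
`{p, q}` pick `l ∈ T ∖ S ∖ {p, q}` (it exists since `|T ∖ S| ≥ 3 > |{p, q}|`).  Then `P_l Q_T f = Q_T f` and
`P_l Q_S f = 0` (`Lnss.cellAvg_modeProj`), the weight is flat in slot `l` (`PlainInteraction.pairWeight_update`)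
and so passes through `P_l` (`PlainInteraction.cellAvg_mul_flat`), and `P_l` is self-adjoint on continuous
functions (`Negative.integral_conj_mul_cellAvg`):
`∫ w conj(Q_S f) Q_T f = ∫ conj(w Q_S f) P_l Q_T f = ∫ conj(P_l(w Q_S f)) Q_T f = ∫ conj(w P_l Q_S f) Q_T f = 0`.
[folklore] (ReedSimonIV1978 §XIII.12, IMS-type localisation; LSSY2005 App. A.)
-/

noncomputable section

open MeasureTheory Filter
open scoped ENNReal NNReal ComplexConjugate

namespace Summit.AtomisticToContinuum.BoseEinsteinCondensation.Cruxes.GDTransfer.Seeded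

namespace InteractionLocalityProof

open Literature.MathematicalPhysics.QuantumManyBody.BoseGas
open Summit.AtomisticToContinuum.BoseEinsteinCondensation.Theorems.GaussianDominationCan.Negative
open Summit.AtomisticToContinuum.BoseEinsteinCondensation.Cruxes.GDTransfer.DysonDressedWitness
open Lnss PlainInteraction

variable {m : ℕ} {L : ℝ}

/-- **One slot kills a weighted cross form.**  For a continuous real weight `w` flat in a slot `l ∈ T`,
`l ∉ S`, and continuous `f, g`: `∫ w conj(Q_S f) (Q_T g) = 0` over `cell^N` (`P_l` is self-adjoint, commutes
with `w`, fixes `Q_T g` and kills `Q_S f`). [folklore] -/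
theorem form_modeProj_eq_zero_of_flat (hL : 0 < L) {S T : Finset (Fin (m + 1))} {l : Fin (m + 1)}
    (hlT : l ∈ T) (hlS : l ∉ S) {w : Config (m + 1) → ℝ} (hw : Continuous w)
    (hwl : ∀ X z, w (Function.update X l z) = w X) {f g : Config (m + 1) → ℂ} (hf : Continuous f)
    (hg : Continuous g) :
    ∫ X in cellN (m + 1) L, ((w X : ℝ) : ℂ) *
        (conj (modeProj (m + 1) L S f X) * modeProj (m + 1) L T g X) = 0 := by
  have hFc : Continuous (modeProj (m + 1) L S f) := ChordVariation.continuous_modeProj S hf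
  have hGc : Continuous (modeProj (m + 1) L T g) := ChordVariation.continuous_modeProj T hg
  -- `P_l Q_T g = Q_T g`, `P_l Q_S f = 0`
  have hPG : cellAvg (m + 1) L l (modeProj (m + 1) L T g) = modeProj (m + 1) L T g := by
    rw [cellAvg_modeProj hL T l hg, if_pos hlT]
  have hPF : cellAvg (m + 1) L l (modeProj (m + 1) L S f) = 0 := by
    rw [cellAvg_modeProj hL S l hf, if_neg hlS]
  -- `H = w · Q_S f` is continuous and `P_l H = w · P_l Q_S f = 0`
  set H : Config (m + 1) → ℂ := fun X => ((w X : ℝ) : ℂ) * modeProj (m + 1) L S f X with hH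
  have hHc : Continuous H := (Complex.continuous_ofReal.comp hw).mul hFc
  have hwu : ∀ (X : Config (m + 1)) (z : Space),
      (((w (Function.update X l z) : ℝ) : ℂ)) = ((w X : ℝ) : ℂ) := fun X z => by rw [hwl]
  have hPH : cellAvg (m + 1) L l H = 0 := by
    rw [hH, cellAvg_mul_flat l hwu (modeProj (m + 1) L S f), hPF]
    funext X
    simp only [Pi.zero_apply, mul_zero]
  calc ∫ X in cellN (m + 1) L, ((w X : ℝ) : ℂ) *
        (conj (modeProj (m + 1) L S f X) * modeProj (m + 1) L T g X)
      = ∫ X in cellN (m + 1) L, conj (H X) * cellAvg (m + 1) L l (modeProj (m + 1) L T g) X := by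
        rw [hPG]
        refine integral_congr_ae (Eventually.of_forall fun X => ?_)
        simp only [hH, map_mul, Complex.conj_ofReal]
        ring
    _ = ∫ X in cellN (m + 1) L, conj (cellAvg (m + 1) L l H X) * modeProj (m + 1) L T g X :=
        integral_conj_mul_cellAvg l hHc hGc
    _ = 0 := by
        rw [hPH]
        simp only [Pi.zero_apply, map_zero, zero_mul, integral_zero]

/-- **A slot of `T ∖ S` outside a given pair**, when `|T ∖ S| ≥ 3`. [folklore] -/
theorem exists_mem_sdiff_ne_ne {S T : Finset (Fin (m + 1))} (hcard : 3 ≤ (T \ S).card) (p q : Fin (m + 1)) :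
    ∃ l, l ∈ T ∧ l ∉ S ∧ p ≠ l ∧ q ≠ l := by
  have hlt : ({p, q} : Finset (Fin (m + 1))).card < (T \ S).card :=
    lt_of_le_of_lt Finset.card_le_two (by omega)
  obtain ⟨l, hl, hlpq⟩ := Finset.exists_mem_notMem_of_card_lt_card hlt
  rw [Finset.mem_sdiff] at hl
  simp only [Finset.mem_insert, Finset.mem_singleton, not_or] at hlpq
  exact ⟨l, hl.1, hl.2, Ne.symm hlpq.1, Ne.symm hlpq.2⟩

/-- **The interaction cross form pair by pair**: for a finite continuous finite-range profile and continuous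
`f, g`, `𝓥(Q_S f, Q_T g) = Σ_p Σ_{q>p} ∫ v^per(x_p − x_q) conj(Q_S f) Q_T g`. [folklore] -/
theorem vform_modeProj_eq_sum_pairs {v : ℝ → ℝ≥0∞} (hv : IsRepulsiveFiniteRange v)
    (hfc : IsFiniteContinuous v) (hL : L ≠ 0) (S T : Finset (Fin (m + 1))) {f g : Config (m + 1) → ℂ}
    (hf : Continuous f) (hg : Continuous g) :
    vform v m L (modeProj (m + 1) L S f) (modeProj (m + 1) L T g) =
      ∑ p : Fin (m + 1), ∑ q ∈ (Finset.univ : Finset (Fin (m + 1))).filter (fun q => p < q),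
        ∫ X in cellN (m + 1) L, (((periodizedPotential v L (X p - X q)).toReal : ℝ) : ℂ) *
          (conj (modeProj (m + 1) L S f X) * modeProj (m + 1) L T g X) := by
  have hFc : Continuous (modeProj (m + 1) L S f) := ChordVariation.continuous_modeProj S hf
  have hGc : Continuous (modeProj (m + 1) L T g) := ChordVariation.continuous_modeProj T hg
  have hpair : ∀ p q : Fin (m + 1),
      Continuous fun X : Config (m + 1) => (periodizedPotential v L (X p - X q)).toReal :=
    fun p q => continuous_pairWeight hv hfc hL p q
  have hrow : ∀ p : Fin (m + 1), Continuous fun X : Config (m + 1) =>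
      ∑ q ∈ (Finset.univ : Finset (Fin (m + 1))).filter (fun q => p < q),
        (periodizedPotential v L (X p - X q)).toReal :=
    fun p => continuous_finsetSum _ fun q _ => hpair p q
  unfold vform
  calc ∫ X in cellN (m + 1) L, (((periodicInteraction v L X).toReal : ℝ) : ℂ) *
        (conj (modeProj (m + 1) L S f X) * modeProj (m + 1) L T g X)
      = ∫ X in cellN (m + 1) L, ((∑ p : Fin (m + 1),
          ∑ q ∈ (Finset.univ : Finset (Fin (m + 1))).filter (fun q => p < q),
            (periodizedPotential v L (X p - X q)).toReal : ℝ) : ℂ) *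
          (conj (modeProj (m + 1) L S f X) * modeProj (m + 1) L T g X) := by
        refine integral_congr_ae (Eventually.of_forall fun X => ?_)
        beta_reduce
        rw [toReal_periodicInteraction hv hfc hL]
    _ = ∑ p : Fin (m + 1), ∫ X in cellN (m + 1) L,
          ((∑ q ∈ (Finset.univ : Finset (Fin (m + 1))).filter (fun q => p < q),
            (periodizedPotential v L (X p - X q)).toReal : ℝ) : ℂ) *
          (conj (modeProj (m + 1) L S f X) * modeProj (m + 1) L T g X) :=
        form_sum_weight (w := fun p X => ∑ q ∈ (Finset.univ : Finset (Fin (m + 1))).filter (fun q => p < q),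
          (periodizedPotential v L (X p - X q)).toReal) Finset.univ (fun p _ => hrow p) hFc hGc
    _ = ∑ p : Fin (m + 1), ∑ q ∈ (Finset.univ : Finset (Fin (m + 1))).filter (fun q => p < q),
          ∫ X in cellN (m + 1) L, (((periodizedPotential v L (X p - X q)).toReal : ℝ) : ℂ) *
            (conj (modeProj (m + 1) L S f X) * modeProj (m + 1) L T g X) :=
        Finset.sum_congr rfl fun p _ =>
          form_sum_weight (w := fun q X => (periodizedPotential v L (X p - X q)).toReal) _
            (fun q _ => hpair p q) hFc hGc

/-- **`Q_S`-bandwidth two, two-function form**: for a finite continuous finite-range profile, `L > 0`,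
`|T ∖ S| ≥ 3` and continuous `f, g`, `𝓥(Q_S f, Q_T g) = 0`. [folklore] -/
theorem vform_modeProj_eq_zero {v : ℝ → ℝ≥0∞} (hv : IsRepulsiveFiniteRange v) (hfc : IsFiniteContinuous v)
    (hL : 0 < L) {S T : Finset (Fin (m + 1))} (hcard : 3 ≤ (T \ S).card) {f g : Config (m + 1) → ℂ}
    (hf : Continuous f) (hg : Continuous g) :
    vform v m L (modeProj (m + 1) L S f) (modeProj (m + 1) L T g) = 0 := by
  rw [vform_modeProj_eq_sum_pairs hv hfc hL.ne' S T hf hg]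
  refine Finset.sum_eq_zero fun p _ => Finset.sum_eq_zero fun q _ => ?_
  obtain ⟨l, hlT, hlS, hpl, hql⟩ := exists_mem_sdiff_ne_ne hcard p q
  exact form_modeProj_eq_zero_of_flat hL hlT hlS (continuous_pairWeight hv hfc hL.ne' p q)
    (fun X z => pairWeight_update v L hpl hql X z) hf hg

end InteractionLocalityProof

/-- **THE INTERACTION FORM HAS `Q_S`-BANDWIDTH TWO** (registered stub `interactionLocality` of the fixed-`N` seed
programme, line `seeded-continuity`): for a finite continuous finite-range profile `v`, `L > 0`, continuous `f` and
`|T ∖ S| ≥ 3`, `𝓥(Q_S f, Q_T f) = 0` — for every pair `{p, q}` some slot `l ∈ T ∖ S` lies outside the pair, the pair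
weight `v^per(x_p − x_q)` commutes with the self-adjoint slot average `P_l`, and `P_l Q_T f = Q_T f`, `P_l Q_S f = 0`.
[folklore] (ReedSimonIV1978 §XIII.12; LSSY2005 App. A.) -/
theorem interactionLocality : InteractionLocality :=
  fun _ hv hfc _ _ hL _ _ hcard _ hf => InteractionLocalityProof.vform_modeProj_eq_zero hv hfc hL hcard hf hf

end Summit.AtomisticToContinuum.BoseEinsteinCondensation.Cruxes.GDTransfer.Seeded

end
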